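import Literature.AlgebraicGeometry.Smoothening.DilatationDefect
import Mathlib.RingTheory.LocalRing.Module
import Mathlib.RingTheory.LocalRing.ResidueField.Basic
import HarnessLib

/-!
# Independence of the differentials of the centre: from the residue field to the point

Topic: `Literature/AlgebraicGeometry/Smoothening` (Bosch–Lütkebohmert–Raynaud, *Néron Models*,
§3.3, Lemma 4 / Prop. 5: the centre `U_k` of the dilatation is smooth over `k`). In the
notation of `DilatationDefect` (`B ⊇ 𝔟̃ = (ϖ, g₁, …, g_r)`, `γⱼ = 1 ⊗ dgⱼ`), smoothness of
the centre at a point enters the defect-drop computation through two independence statements,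
both consequences of the linear independence of the residues `dḡⱼ(x) ∈ κ(x) ⊗_B Ω[B⁄R]`:

* `dvd_of_linearIndependent_residue` — **the hypothesis `hγ` of `DilatationLattice` /
  `DilatationDefect`**: for a point `a : B → S` with values in a discrete valuation ring `S`
  (uniformizer `π`, residue field `k'`), if the `1 ⊗ dgⱼ ∈ k' ⊗_B Ω[B⁄R]` are `k'`-linearly
  independent then `Σ cⱼ γⱼ ∈ π (S ⊗_B Ω[B⁄R])` forces `π ∣ cⱼ`;
* `exists_mul_mem_of_linearIndependent_residue` — **the hypothesis `hind` of
  `CentreLinearPart`**: on the centre `C = B/𝔟̃`, at a prime `𝔓`, if the `1 ⊗ dgⱼ` are linearly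
  independent in `κ(𝔓) ⊗_B Ω[B⁄R]` then a vanishing `C`-combination `Σ c̄ⱼ (1 ⊗ dgⱼ) = 0` in
  `C ⊗_B Ω[B⁄R]` has `t cⱼ ∈ 𝔟̃` for some `t ∉ 𝔓` (independence over the local ring `C_𝔓` by
  Mathlib's `IsLocalRing.linearIndependent_of_flat`, `Ω[B⁄R]` being free).

[folklore] linear algebra; no named facts (D-0026).

## References

* S. Bosch, W. Lütkebohmert, M. Raynaud, *Néron Models*, Springer 1990, §3.3, Lemma 4.
  [BLRNeronModels1990] (Not held; number only.)
-/

noncomputable section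

open scoped TensorProduct
open KaehlerDifferential IsLocalRing

namespace Literature.AlgebraicGeometry.Smoothening

universe u

/-! ### At a discrete valuation ring point: the hypothesis `hγ` -/

section Point

variable {R : Type u} [CommRing R] {B : Type u} [CommRing B] [Algebra R B]
  {r : ℕ} (g : Fin r → B)
  (S : Type u) [CommRing S] [IsDomain S] [IsDiscreteValuationRing S] [Algebra B S]
  {π : S}

/-- **`hγ` from the residues.** If the residues `1 ⊗ dgⱼ ∈ k' ⊗_B Ω[B⁄R]` (`k'` the residue
field of the discrete valuation ring `S`, an algebra over `B` through the point) are linearly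
independent, then `Σ cⱼ (1 ⊗ dgⱼ) ∈ π (S ⊗_B Ω[B⁄R])` forces `π ∣ cⱼ` for all `j`. [folklore] -/
theorem dvd_of_linearIndependent_residue (hπ : Irreducible π)
    (hind : LinearIndependent (ResidueField S)
      (fun j => (1 : ResidueField S) ⊗ₜ[B] D R B (g j))) (c : Fin r → S)
    (hc : ∃ y : S ⊗[B] Ω[B⁄R], ∑ j, c j • centreVec S g j = π • y) (j : Fin r) : π ∣ c j := by
  classical
  obtain ⟨y, hy⟩ := hc
  -- reduce modulo `π`: apply `x ↦ 1 ⊗ x : F → k' ⊗_S F ≅ k' ⊗_B Ω[B⁄R]`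
  let e := TensorProduct.AlgebraTensorModule.cancelBaseChange B S (ResidueField S) (ResidueField S)
    Ω[B⁄R]
  have h1 : ∀ x : S ⊗[B] Ω[B⁄R], ∀ s : S,
      e ((1 : ResidueField S) ⊗ₜ[S] (s • x)) = residue S s • e ((1 : ResidueField S) ⊗ₜ[S] x) := by
    intro x s
    rw [TensorProduct.tmul_smul, ← algebraMap_smul (ResidueField S) s ((1 : ResidueField S) ⊗ₜ[S] x),
      map_smul, ResidueField.algebraMap_eq]
  have hγe : ∀ j, e ((1 : ResidueField S) ⊗ₜ[S] centreVec S g j) =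
      (1 : ResidueField S) ⊗ₜ[B] D R B (g j) := by
    intro j
    rw [centreVec, TensorProduct.AlgebraTensorModule.cancelBaseChange_tmul, one_smul]
  have key := congrArg (fun x => e ((1 : ResidueField S) ⊗ₜ[S] x)) hy
  simp only [TensorProduct.tmul_sum, map_sum, h1, hγe] at key
  -- `π y ↦ 0`
  have hπ0 : residue S π = 0 := (residue_eq_zero_iff π).mpr (hπ.maximalIdeal_eq ▸ Ideal.mem_span_singleton_self π)
  rw [hπ0, zero_smul] at key
  have hcj := (Fintype.linearIndependent_iff.mp hind) (fun j => residue S (c j)) key j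
  rw [residue_eq_zero_iff, hπ.maximalIdeal_eq, Ideal.mem_span_singleton] at hcj
  exact hcj

end Point

/-! ### On the centre: the hypothesis `hind` -/

section Centre

variable {R : Type u} [CommRing R] (ϖ : R) {B : Type u} [CommRing B] [Algebra R B]
  {r : ℕ} (g : Fin r → B) [Module.Free B Ω[B⁄R]]
  (𝔓 : Ideal (B ⧸ centreIdealB ϖ g)) [𝔓.IsPrime]
  (L : Type u) [CommRing L] [IsLocalRing L] [Algebra (B ⧸ centreIdealB ϖ g) L]
  [IsLocalization.AtPrime L 𝔓] [Algebra B L] [IsScalarTower B (B ⧸ centreIdealB ϖ g) L]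

/-- **`hind` from the residues.** Let `C = B/𝔟̃` be the coordinate ring of the centre, `𝔓` a
prime of `C` and `L = C_𝔓`. If the `1 ⊗ dgⱼ ∈ κ(𝔓) ⊗_B Ω[B⁄R]` are `κ(𝔓)`-linearly independent
(`Ω[B⁄R]` free: `B` a polynomial ring), then every vanishing `C`-combination
`Σ c̄ⱼ (1 ⊗ dgⱼ) = 0` in `C ⊗_B Ω[B⁄R]` has `t cⱼ ∈ 𝔟̃` for some `t ∈ B` with `t̄ ∉ 𝔓`
(Mathlib `IsLocalRing.linearIndependent_of_flat` over `L`). [folklore] -/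
theorem exists_mul_mem_of_linearIndependent_residue
    (hind : LinearIndependent (ResidueField L)
      (fun j => (1 : ResidueField L) ⊗ₜ[B] D R B (g j)))
    (c : Fin r → B)
    (hc : ∑ j, Ideal.Quotient.mk (centreIdealB ϖ g) (c j) •
      ((1 : B ⧸ centreIdealB ϖ g) ⊗ₜ[B] D R B (g j)) = 0) :
    ∃ t : B, Ideal.Quotient.mk (centreIdealB ϖ g) t ∉ 𝔓 ∧ ∀ j, t * c j ∈ centreIdealB ϖ g := by
  classical
  -- the vectors `vⱼ = 1 ⊗ dgⱼ ∈ L ⊗_B Ω[B⁄R]` are `L`-linearly independent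
  let v : ULift.{u} (Fin r) → L ⊗[B] Ω[B⁄R] := fun j => (1 : L) ⊗ₜ[B] D R B (g j.down)
  have hv : LinearIndependent L v := by
    refine Module.IsLocalRing.linearIndependent_of_flat v ?_
    let e := TensorProduct.AlgebraTensorModule.cancelBaseChange B L (ResidueField L) (ResidueField L)
      Ω[B⁄R]
    refine LinearIndependent.of_comp e.toLinearMap ?_
    have : ⇑e.toLinearMap ∘ (TensorProduct.mk L (ResidueField L) (L ⊗[B] Ω[B⁄R]) 1 ∘ v) =
        (fun j => (1 : ResidueField L) ⊗ₜ[B] D R B (g j)) ∘ ULift.down := by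
      funext j
      simp only [Function.comp_apply, TensorProduct.mk_apply, LinearEquiv.coe_coe, v]
      rw [TensorProduct.AlgebraTensorModule.cancelBaseChange_tmul, one_smul]
    rw [this]
    exact hind.comp _ ULift.down_injective
  -- map the relation to `L ⊗_B Ω[B⁄R]`
  let φ : (B ⧸ centreIdealB ϖ g) ⊗[B] Ω[B⁄R] →ₗ[B] L ⊗[B] Ω[B⁄R] :=
    LinearMap.rTensor Ω[B⁄R] ((Algebra.linearMap (B ⧸ centreIdealB ϖ g) L).restrictScalars B)
  have hφ : ∀ (x : B ⧸ centreIdealB ϖ g) (ω : Ω[B⁄R]),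
      φ (x • ((1 : B ⧸ centreIdealB ϖ g) ⊗ₜ[B] ω)) = algebraMap _ L x • ((1 : L) ⊗ₜ[B] ω) := by
    intro x ω
    rw [TensorProduct.smul_tmul', smul_eq_mul, mul_one, LinearMap.rTensor_tmul,
      TensorProduct.smul_tmul', smul_eq_mul, mul_one]
    rfl
  have key := congrArg φ hc
  simp only [map_sum, hφ, map_zero] at key
  -- independence over `L`: all coefficients vanish in `L`
  have hzero : ∀ j, algebraMap (B ⧸ centreIdealB ϖ g) L (Ideal.Quotient.mk _ (c j)) = 0 := by
    have h := Fintype.linearIndependent_iff.mp hv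
      (fun j => algebraMap (B ⧸ centreIdealB ϖ g) L (Ideal.Quotient.mk _ (c j.down))) (by
        rw [← key, ← Equiv.ulift.symm.sum_comp]
        rfl)
    exact fun j => h ⟨j⟩
  -- hence killed by an element of `𝔓ᶜ`
  have hkill : ∀ j, ∃ s : (B ⧸ centreIdealB ϖ g), s ∉ 𝔓 ∧ s * Ideal.Quotient.mk _ (c j) = 0 := by
    intro j
    obtain ⟨⟨s, hs⟩, hsc⟩ := (IsLocalization.map_eq_zero_iff 𝔓.primeCompl L _).mp (hzero j)
    exact ⟨s, hs, by simpa using hsc⟩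
  choose s hs hsc using hkill
  refine ⟨∏ j, (Ideal.Quotient.mk_surjective (s j)).choose, ?_, fun j => ?_⟩
  · rw [map_prod]
    simp only [(Ideal.Quotient.mk_surjective (s _)).choose_spec]
    exact Submonoid.prod_mem (𝔓.primeCompl) fun j _ => hs j
  · rw [← Ideal.Quotient.eq_zero_iff_mem, map_mul, map_prod]
    simp only [(Ideal.Quotient.mk_surjective (s _)).choose_spec]
    rw [← Finset.mul_prod_erase Finset.univ s (Finset.mem_univ j), mul_comm (s j), mul_assoc, hsc,
      mul_zero]

end Centre

/-! ### Descending the residue independence along a field extension -/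

section Descend

variable {B : Type u} [CommRing B] {R : Type u} [CommRing R] [Algebra R B]
  (κ : Type u) [Field κ] [Algebra B κ] (k' : Type u) [Field k'] [Algebra B k'] [Algebra κ k']
  [IsScalarTower B κ k'] {r : ℕ} (g : Fin r → B)

/-- If the `1 ⊗ dgⱼ ∈ k' ⊗_B Ω[B⁄R]` are `k'`-linearly independent for a field extension `κ → k'`
compatible with the `B`-algebra structures, then the `1 ⊗ dgⱼ ∈ κ ⊗_B Ω[B⁄R]` are
`κ`-linearly independent (so the hypothesis `hresκ` at the closed point of the centre follows
from `hres` at the residue field of the valuation ring). [folklore] -/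
theorem linearIndependent_residue_descend
    (hind : LinearIndependent k' (fun j => (1 : k') ⊗ₜ[B] D R B (g j))) :
    LinearIndependent κ (fun j => (1 : κ) ⊗ₜ[B] D R B (g j)) := by
  -- the `κ`-linear map `κ ⊗_B Ω → k' ⊗_B Ω`, `1 ⊗ ω ↦ 1 ⊗ ω`
  let e := TensorProduct.AlgebraTensorModule.cancelBaseChange B κ k' k' Ω[B⁄R]
  let ψ : κ ⊗[B] Ω[B⁄R] →ₗ[κ] k' ⊗[B] Ω[B⁄R] :=
    (e.toLinearMap.restrictScalars κ) ∘ₗ TensorProduct.mk κ k' (κ ⊗[B] Ω[B⁄R]) 1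
  have hψ : ∀ ω : Ω[B⁄R], ψ ((1 : κ) ⊗ₜ[B] ω) = (1 : k') ⊗ₜ[B] ω := fun ω => by
    simp only [ψ, LinearMap.comp_apply, TensorProduct.mk_apply, LinearMap.coe_restrictScalars,
      LinearEquiv.coe_coe, e]
    rw [TensorProduct.AlgebraTensorModule.cancelBaseChange_tmul, one_smul]
  refine LinearIndependent.of_comp ψ ?_
  have hcomp : ⇑ψ ∘ (fun j => (1 : κ) ⊗ₜ[B] D R B (g j)) = fun j => (1 : k') ⊗ₜ[B] D R B (g j) :=
    funext fun j => hψ _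
  rw [hcomp]
  exact hind.restrict_scalars' κ

end Descend

end Literature.AlgebraicGeometry.Smoothening
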